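import Mathlib
import Summits.NavierStokesRegularity.NavierStokesRegularity.Theorems.TaoLadderRungTwoBreakBlowupRigidityOneSurvivingEternalLimit
import HarnessLib

/-!
# THE CONDITIONAL EXTRACTION AT ν = 0: a PINNED inviscid blow-up (type I + action/energy ceilings + firing floor with
  two-sided self-similar clock at a surviving energy ratio) has an ADMISSIBLE, UNIFORMLY BOUNDED, FORWARD-SURVIVING
  eternal ω-limit — the conclusion of the registered stub `stub_eternalFromBlowup` of K2(1)
  `TaoLadderRungTwoBreak.BlowupRigidityOne` (stmt-NavierStokesRegularity-20206), MODULO the pinning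

MODEL lattice ODEs only (Tao 2016 §4 (4.8)/(4.12), §6.4); nothing here is a statement about the Navier–Stokes
equations; NO item is closed (`--supports stmt-NavierStokesRegularity-20206`). Route-independent (general `m` for the
extraction; `m = 4` only in the stub-shaped corollary).

* `survivingEternalLimit_of_pinned` — **(E4) AS A THEOREM, general exponent `a`**: exact flow on `[0,T)` + TYPE I +
  per-shell action ceiling + energy ceiling `‖x_k‖² ≤ Cₑ μ^k` + firing times with floor `c_f μ^k ≤ ‖x_k(τ_k)‖²` and
  two-sided clock `κ₁ ≤ (Λ²μ)^k (T-τ_k)² ≤ κ₂` + `Λ²μ > 1` + `1 ≤ physWeight a ε₀ · Λ²μ`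
  ⇒ `∃ W, IsEternal ε₀ α W ∧ UniformBound W ∧ EternalSurvivingFwd a ε₀ W`
  (`admissibleEternalLimit_of_ceilings` with the firing-centred, clock-compatible centring + `survivingFwd_of_firingLimit`).
* `eternal_surviving_one_of_pinned` — the case `a = 1` under the (S₁) clause `(1+ε₀)⁻¹ ≤ μ` (then `Λ²μ ≥ (1+ε₀)^4 > 1`
  and the weight threshold hold automatically).
* `stub_eternalFromBlowup_of_pinnedBlowups` — **THE REGISTERED STUB MODULO ONE BLOW-UP-SIDE HYPOTHESIS**: if, below a
  threshold `ε_s(R)`, every robust blow-up (`NoGlobalCascade`) of a table of `E₂(R)` comes with SOME exact flow of that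
  table pinned at an (S₁)-surviving ratio (the bundle (E2)+(E3) of the item's census, spelled out — no new definition),
  then the signature of `stub_eternalFromBlowup` holds VERBATIM.

HONEST LABEL: the hypothesis bundle is OPEN (type I for robust inviscid blow-up of a fixed-spread table = cell risk N-39;
the ceilings / floor / clock = the asymptotic self-similarity of the blow-up, (E2)); this file only removes (E4) from the
list. `stub_eternalIsDSS` (classification) untouched. No stub, crux or summit is proved here.
-/

noncomputable section

-- the summit and its single sub-problem share the name (CONVENTIONS §1)
set_option linter.dupNamespace false

open Set Filter Topology MeasureTheory

namespace Summit.NavierStokesRegularity.NavierStokesRegularity.Theorems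

namespace BlowupRigidityOne

open Literature.Analysis.FluidPDE Literature.Analysis.FluidPDE.TaoCascade

variable {m : ℕ}

/-- **PINNED INVISCID BLOW-UP ⇒ ADMISSIBLE, UNIFORMLY BOUNDED, FORWARD (S_a)-SURVIVING ETERNAL ω-LIMIT** (the
extraction (E4) at ν = 0 and general energy ratio `μ`). Hypotheses: an exact flow `X` of the table `α` on `[0,T)`
(`C¹`, exact one-sided law) with renormalisation `W̃`; TYPE I (`Λ^n(T-t)‖x_n(t)‖ ≤ C`); per-shell ACTION ceiling
(`Λ^k ∫_{[0,T)}‖x_k‖ ≤ A`); ENERGY ceiling (`‖x_k(t)‖² ≤ Cₑ μ^k`); firing times `τ_k ∈ [0,T)` (`k ∈ ℕ`) with FLOOR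
`c_f μ^k ≤ ‖x_k(τ_k)‖²` and two-sided CLOCK `κ₁ ≤ (Λ²μ)^k (T-τ_k)² ≤ κ₂`; `Λ²μ > 1`; and the weight threshold
`1 ≤ physWeight a ε₀ · Λ²μ` (⟸ `(1+ε₀)^{-a} ≤ μ`, `physWeight_mul_ge_one_of_surviving`). Conclusion:
`∃ W, IsEternal ε₀ α W ∧ UniformBound W ∧ EternalSurvivingFwd a ε₀ W` — `W` a continuous limit of the firing-centred
translates `W̃_{n+j}(· - log(T-τ_j))`.
[cite: Tao2016AveragedNS, §4 Thm. 4.2 (statement shape), (4.8)–(4.10), §6.4; KochNadirashviliSereginSverak2009, Thm 1.1 ff. (rescaling-compactness); Teschl2012, §2.6; cell vocabulary (`IsEternal`, `UniformBound`, `EternalSurvivingFwd`)] -/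
theorem survivingEternalLimit_of_pinned {ε₀ T C A μ Cₑ cf κ₁ κ₂ a : ℝ} (hε : 0 < ε₀) (hT : 0 < T)
    {α : Fin m → Fin m → Fin m → ℤ × ℤ × ℤ → ℝ}
    {X : Fin m → ℤ → ℝ → ℝ} (hC1 : ∀ i n, ContDiffOn ℝ 1 (X i n) (Set.Ico 0 T))
    (hmot : ∀ i n t, 0 ≤ t → t < T → derivWithin (X i n) (Set.Ici 0) t = quadTerm ε₀ α X i n t)
    {W : ℤ → ℝ → Em m}
    (hW : ∀ n σ, W n σ = (bigLam ε₀ ^ n * Real.exp (-σ)) • shellVec X n (T - Real.exp (-σ)))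
    (htypeI : ∀ (n : ℤ) (t : ℝ), 0 ≤ t → t < T → bigLam ε₀ ^ n * (T - t) * ‖shellVec X n t‖ ≤ C)
    (hact : ∀ k : ℤ, IntegrableOn (fun t => ‖shellVec X k t‖) (Ico 0 T) ∧
      bigLam ε₀ ^ k * (∫ t in Ico 0 T, ‖shellVec X k t‖) ≤ A)
    (hμ : 0 < μ) (hE : ∀ (k : ℤ) (t : ℝ), 0 ≤ t → t < T → ‖shellVec X k t‖ ^ 2 ≤ Cₑ * μ ^ k)
    {τ : ℕ → ℝ} (hτ : ∀ k : ℕ, 0 ≤ τ k ∧ τ k < T)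
    (hfloor : ∀ k : ℕ, cf * μ ^ k ≤ ‖shellVec X (k : ℤ) (τ k)‖ ^ 2)
    (hclock₁ : ∀ k : ℕ, κ₁ ≤ (bigLam ε₀ ^ 2 * μ) ^ k * (T - τ k) ^ 2)
    (hclock₂ : ∀ k : ℕ, (bigLam ε₀ ^ 2 * μ) ^ k * (T - τ k) ^ 2 ≤ κ₂)
    (hcf : 0 < cf) (hκ₁ : 0 < κ₁) (hκ₂ : 0 < κ₂) (hq1 : 1 < bigLam ε₀ ^ 2 * μ)
    (hpw : 1 ≤ physWeight a ε₀ * (bigLam ε₀ ^ 2 * μ)) :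
    ∃ Wlim : ℤ → ℝ → Em m, IsEternal ε₀ α Wlim ∧ UniformBound Wlim ∧ EternalSurvivingFwd a ε₀ Wlim := by
  have hΛ : 0 < bigLam ε₀ := bigLam_pos (by linarith)
  set q : ℝ := bigLam ε₀ ^ 2 * μ with hq_def
  have hq : 0 < q := by positivity
  -- the firing-centred centring: shell shift `j`, log-time shift `s_j = -log(T - τ_j) → +∞`
  have gap : ∀ j : ℕ, 0 < T - τ j := fun j => by linarith [(hτ j).2]
  have hlow : ∀ j : ℕ, ((j : ℝ) * Real.log q - Real.log κ₂) / 2 ≤ -Real.log (T - τ j) := by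
    intro j
    have h1 : (T - τ j) ^ 2 ≤ κ₂ / q ^ j := by
      rw [le_div_iff₀ (pow_pos hq j), mul_comm]; exact hclock₂ j
    have h2 : Real.log ((T - τ j) ^ 2) ≤ Real.log (κ₂ / q ^ j) := Real.log_le_log (pow_pos (gap j) 2) h1
    rw [Real.log_pow, Real.log_div hκ₂.ne' (pow_pos hq j).ne', Real.log_pow] at h2
    push_cast at h2
    linarith
  have hs : Tendsto (fun j : ℕ => -Real.log (T - τ j)) atTop atTop := by
    have hlq : 0 < Real.log q := Real.log_pos hq1
    have h1 : Tendsto (fun j : ℕ => ((j : ℝ) * Real.log q + -Real.log κ₂) / 2) atTop atTop :=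
      (tendsto_atTop_add_const_right _ _ (tendsto_natCast_atTop_atTop.atTop_mul_const hlq)).atTop_div_const
        two_pos
    refine tendsto_atTop_mono (fun j => ?_) h1
    have := hlow j
    rwa [sub_eq_add_neg] at this
  -- clock-compatibility of the centring: `(Λ²μ)^j e^{-2 s_j} = (Λ²μ)^j (T-τ_j)² ≤ κ₂`
  have hM : ∀ j : ℕ, q ^ ((fun j : ℕ => (j : ℤ)) j) * Real.exp (-(2 * (fun j : ℕ => -Real.log (T - τ j)) j)) ≤ κ₂ := by
    intro j
    have e : Real.exp (-(2 * -Real.log (T - τ j))) = (T - τ j) ^ 2 := by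
      rw [show -(2 * -Real.log (T - τ j)) = Real.log (T - τ j) + Real.log (T - τ j) by ring, Real.exp_add,
        Real.exp_log (gap j), sq]
    simp only [zpow_natCast, e]
    exact hclock₂ j
  obtain ⟨φ, hφ, Wlim, hconv, hEt, hUB, -, -⟩ := admissibleEternalLimit_of_ceilings hε hT hC1 hmot hW htypeI hact
    hμ hE (fun j : ℕ => (j : ℤ)) (fun j : ℕ => -Real.log (T - τ j)) hs hM
  have hconv' : ∀ (n : ℤ) (v : ℕ → ℝ) (σ : ℝ), Tendsto v atTop (𝓝 σ) →
      Tendsto (fun j => W (n + ((φ j : ℕ) : ℤ)) (v j + -Real.log (T - τ (φ j)))) atTop (𝓝 (Wlim n σ)) :=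
    fun n v σ hv => by simpa only using hconv n v σ hv
  exact ⟨Wlim, hEt, hUB,
    survivingFwd_of_firingLimit hε hW hμ hcf hκ₁ hκ₂ hq1 hpw hτ hfloor hclock₁ hclock₂ (φ := φ) hconv'⟩

/-- **The case `a = 1`**: under the (S₁) clause `(1+ε₀)⁻¹ ≤ μ` of the pinning ratio, the weight threshold and
`Λ²μ ≥ (1+ε₀)^4 > 1` are automatic, and the pinned inviscid blow-up has an admissible, uniformly bounded eternal
ω-limit that is (S₁)-SURVIVING FORWARD — literally the conclusion `∃ W, IsEternal ε₀ α W ∧ EternalSurvivingFwd 1 ε₀ W`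
of the registered stub `stub_eternalFromBlowup`, plus `UniformBound`.
[cite: Tao2016AveragedNS, §4 Thm. 4.2, (4.8)–(4.10), §6.4; KochNadirashviliSereginSverak2009, Thm 1.1 ff.; cell vocabulary] -/
theorem eternal_surviving_one_of_pinned {ε₀ T C A μ Cₑ cf κ₁ κ₂ : ℝ} (hε : 0 < ε₀) (hT : 0 < T)
    {α : Fin m → Fin m → Fin m → ℤ × ℤ × ℤ → ℝ}
    {X : Fin m → ℤ → ℝ → ℝ} (hC1 : ∀ i n, ContDiffOn ℝ 1 (X i n) (Set.Ico 0 T))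
    (hmot : ∀ i n t, 0 ≤ t → t < T → derivWithin (X i n) (Set.Ici 0) t = quadTerm ε₀ α X i n t)
    (htypeI : ∀ (n : ℤ) (t : ℝ), 0 ≤ t → t < T → bigLam ε₀ ^ n * (T - t) * ‖shellVec X n t‖ ≤ C)
    (hact : ∀ k : ℤ, IntegrableOn (fun t => ‖shellVec X k t‖) (Ico 0 T) ∧
      bigLam ε₀ ^ k * (∫ t in Ico 0 T, ‖shellVec X k t‖) ≤ A)
    (hμ1 : (1 + ε₀)⁻¹ ≤ μ) (hE : ∀ (k : ℤ) (t : ℝ), 0 ≤ t → t < T → ‖shellVec X k t‖ ^ 2 ≤ Cₑ * μ ^ k)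
    {τ : ℕ → ℝ} (hτ : ∀ k : ℕ, 0 ≤ τ k ∧ τ k < T)
    (hfloor : ∀ k : ℕ, cf * μ ^ k ≤ ‖shellVec X (k : ℤ) (τ k)‖ ^ 2)
    (hclock₁ : ∀ k : ℕ, κ₁ ≤ (bigLam ε₀ ^ 2 * μ) ^ k * (T - τ k) ^ 2)
    (hclock₂ : ∀ k : ℕ, (bigLam ε₀ ^ 2 * μ) ^ k * (T - τ k) ^ 2 ≤ κ₂)
    (hcf : 0 < cf) (hκ₁ : 0 < κ₁) (hκ₂ : 0 < κ₂) :
    ∃ Wlim : ℤ → ℝ → Em m, IsEternal ε₀ α Wlim ∧ UniformBound Wlim ∧ EternalSurvivingFwd 1 ε₀ Wlim := by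
  have hb : (0 : ℝ) < 1 + ε₀ := by linarith
  have hμ : 0 < μ := lt_of_lt_of_le (inv_pos.2 hb) hμ1
  have hpw : 1 ≤ physWeight 1 ε₀ * (bigLam ε₀ ^ 2 * μ) :=
    physWeight_mul_ge_one_of_surviving hε (a := 1) (by rwa [Real.rpow_neg_one])
  have hq1 : 1 < bigLam ε₀ ^ 2 * μ := by
    rw [bigLam_sq hε]
    have h4 : (1 : ℝ) < (1 + ε₀) ^ 4 := one_lt_pow₀ (by linarith) (by norm_num)
    have h5 : (1 + ε₀) ^ 4 ≤ (1 + ε₀) ^ 5 * μ := by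
      calc (1 + ε₀) ^ 4 = (1 + ε₀) ^ 5 * (1 + ε₀)⁻¹ := by field_simp
        _ ≤ (1 + ε₀) ^ 5 * μ := mul_le_mul_of_nonneg_left hμ1 (pow_pos hb 5).le
    exact lt_of_lt_of_le h4 h5
  -- the renormalisation exists as a function
  set W : ℤ → ℝ → Em m := fun n σ => (bigLam ε₀ ^ n * Real.exp (-σ)) • shellVec X n (T - Real.exp (-σ)) with hW
  exact survivingEternalLimit_of_pinned hε hT hC1 hmot (W := W) (fun n σ => rfl) htypeI hact hμ hE hτ hfloor
    hclock₁ hclock₂ hcf hκ₁ hκ₂ hq1 hpw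

/-- **THE REGISTERED STUB `stub_eternalFromBlowup` MODULO THE PINNING BUNDLE (E2)+(E3).** If for every spread `R ≥ 1`
there is a threshold below which every ROBUST BLOW-UP (`NoGlobalCascade ε₀ α X₀`) of a table `α ∈ E₂(R)` admits SOME
exact flow of `α` on some `[0,T)` that is TYPE I and PINNED at an (S₁)-surviving energy ratio `μ ≥ (1+ε₀)⁻¹`
(per-shell action ceiling, energy ceiling `Cₑ μ^k`, firing floor `c_f μ^k` with two-sided clock
`κ₁ ≤ (Λ²μ)^k (T-τ_k)² ≤ κ₂`) — the OPEN blow-up-side content of the stub, spelled out with no new definition — then the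
signature of `stub_eternalFromBlowup` (skeleton `9d85f4d387c689cd` of item 20206) holds verbatim:
`∀ R ≥ 1, ∃ ε_s > 0, ∀ ε₀ ∈ (0, ε_s], ∀ α X₀, InTableClass R α → NoGlobalCascade ε₀ α X₀ → ∃ W, IsEternal ε₀ α W ∧
EternalSurvivingFwd 1 ε₀ W`.
[cite: Tao2016AveragedNS, §4 Thm. 4.2, §6.4; KochNadirashviliSereginSverak2009, Thm 1.1 ff.; cell vocabulary (`NoGlobalCascade`, `IsEternal`, `EternalSurvivingFwd`)] -/
theorem stub_eternalFromBlowup_of_pinnedBlowups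
    (H : ∀ R : ℝ, 1 ≤ R → ∃ εs : ℝ, 0 < εs ∧ ∀ ε₀ : ℝ, 0 < ε₀ → ε₀ ≤ εs →
      ∀ (α : (Fin 4 → Fin 4 → Fin 4 → ℤ × ℤ × ℤ → ℝ)) (X₀ : Fin 4 → ℝ),
        InTableClass R α → NoGlobalCascade ε₀ α X₀ →
        ∃ (T C A μ Cₑ cf κ₁ κ₂ : ℝ) (X : Fin 4 → ℤ → ℝ → ℝ) (τ : ℕ → ℝ), 0 < T ∧
          (∀ i n, ContDiffOn ℝ 1 (X i n) (Set.Ico 0 T)) ∧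
          (∀ i n t, 0 ≤ t → t < T → derivWithin (X i n) (Set.Ici 0) t = quadTerm ε₀ α X i n t) ∧
          (∀ (n : ℤ) (t : ℝ), 0 ≤ t → t < T → bigLam ε₀ ^ n * (T - t) * ‖shellVec X n t‖ ≤ C) ∧
          (∀ k : ℤ, IntegrableOn (fun t => ‖shellVec X k t‖) (Ico 0 T) ∧
            bigLam ε₀ ^ k * (∫ t in Ico 0 T, ‖shellVec X k t‖) ≤ A) ∧
          (1 + ε₀)⁻¹ ≤ μ ∧
          (∀ (k : ℤ) (t : ℝ), 0 ≤ t → t < T → ‖shellVec X k t‖ ^ 2 ≤ Cₑ * μ ^ k) ∧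
          (∀ k : ℕ, 0 ≤ τ k ∧ τ k < T) ∧
          (∀ k : ℕ, cf * μ ^ k ≤ ‖shellVec X (k : ℤ) (τ k)‖ ^ 2) ∧
          (∀ k : ℕ, κ₁ ≤ (bigLam ε₀ ^ 2 * μ) ^ k * (T - τ k) ^ 2) ∧
          (∀ k : ℕ, (bigLam ε₀ ^ 2 * μ) ^ k * (T - τ k) ^ 2 ≤ κ₂) ∧
          0 < cf ∧ 0 < κ₁ ∧ 0 < κ₂) :
    ∀ R : ℝ, 1 ≤ R → ∃ εs : ℝ, 0 < εs ∧ ∀ ε₀ : ℝ, 0 < ε₀ → ε₀ ≤ εs →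
      ∀ (α : (Fin 4 → Fin 4 → Fin 4 → ℤ × ℤ × ℤ → ℝ)) (X₀ : Fin 4 → ℝ),
        Literature.Analysis.FluidPDE.TaoCascade.InTableClass R α →
        Literature.Analysis.FluidPDE.TaoCascade.NoGlobalCascade ε₀ α X₀ →
        ∃ W : ℤ → ℝ → Literature.Analysis.FluidPDE.TaoCascade.Em 4,
          Literature.Analysis.FluidPDE.TaoCascade.IsEternal ε₀ α W ∧
          Literature.Analysis.FluidPDE.TaoCascade.EternalSurvivingFwd 1 ε₀ W := by
  intro R hR
  obtain ⟨εs, hεs, hH⟩ := H R hR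
  refine ⟨εs, hεs, fun ε₀ hε hεle α X₀ hα hNG => ?_⟩
  obtain ⟨T, C, A, μ, Cₑ, cf, κ₁, κ₂, X, τ, hT, hC1, hmot, htypeI, hact, hμ1, hE, hτ, hfloor, hclock₁, hclock₂,
    hcf, hκ₁, hκ₂⟩ := hH ε₀ hε hεle α X₀ hα hNG
  obtain ⟨W, hW, -, hS⟩ := eternal_surviving_one_of_pinned hε hT hC1 hmot htypeI hact hμ1 hE hτ hfloor hclock₁
    hclock₂ hcf hκ₁ hκ₂
  exact ⟨W, hW, hS⟩

end BlowupRigidityOne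

end Summit.NavierStokesRegularity.NavierStokesRegularity.Theorems

end
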